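import Literature.RepresentationTheory.ClassicalInvariants.SymplecticTensorFFTColoured
import HarnessLib

/-!
# The tensor FFT for a product of symplectic groups with DIFFERENT alphabets per colour
# (Goodman–Wallach Thm. 5.3.3 (2), coloured, block form): invariants of `∏ᵢ Sp(Vᵢ)`, `dim Vᵢ = Nᵢ`,
# in `⊗ᵢ Vᵢ^{⊗ Pᵢ}` are spanned by the colour-respecting complete contractions

Topic `Literature/RepresentationTheory/ClassicalInvariants`; sequel of `SymplecticTensorFFTColoured`, which
proves the coloured statement for a UNIFORM alphabet `Fin N` (all `Vᵢ` of the same dimension) and lists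
"different alphabets `N_i` per colour" under NOT HERE. This file removes that restriction, in the shape
where the positions are GROUPED BY COLOUR: colours `ι` (finite), for each colour `i` a finite set of
positions `P i`, an alphabet `Fin (N i)` and an alternating nondegenerate form `Ω i` on `K^{N i}`; words
are dependent functions `w : (i : ι) → P i → Fin (N i)` (coefficient tensors on `⊗ᵢ Vᵢ^{⊗ P i}`), and
`Sp(Ω i)` acts on the colour-`i` block of a word by the Kronecker power `g^{⊗ P i}`
(`Function.update w i u`, all other blocks fixed). Needed with two colours of different dimensions
(`Sp(M₊) × Sp(M₋)`, `dim M₊ ≠ dim M₋`) by the cell `hodge-nonav` (route `SignSymmetricPowers`, crux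
`PowersHodgeOfSignCommutators`; memo LIT-TREECOVER-SIGN GAP-1).

## Source

R. Goodman, N. R. Wallach, *Symmetry, Representations, and Invariants*, GTM 255 (2009)
[`book:goodmannd-symmetry-representations-invariants`, held]: Thm. 5.3.3 (2) / Thm. 5.3.5 (PDF pp. 347–349,
one symplectic group: the complete contractions span the invariant multilinear forms) and the factorization
of invariants of a product group acting factor by factor (§4.1.1), exactly as in the uniform-alphabet file;
Milne, *Lefschetz classes on abelian varieties*, Duke 96 (1999), p. 656 (the same factorization over the
simple factors `S_σ` of possibly different ranks). The block statement is the form in which the theorem is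
USED for `∏ Sp(Vᵢ)` with unequal `dim Vᵢ`; it is assembled here from the cited one-colour theorem
(the tree's `mem_span_completeContractionOn_inv_of_sp_invariant`, any finite position type) by the cited
factorization (the tree's `exists_sum_mul_of_slices_mem`).

## What is here (all proved; `char K = 0`)

* §1 `TwoPartition P` (`Σ k, P ≃ Fin 2 × Fin k`), `blockContraction Θ e` (`w ↦ ∏ᵢ λ_{e i}(Θ i)(w i)`),
  `joinAt i₀ u r` (the word with colour-`i₀` block `u` and the other blocks `r`, via `Equiv.piSplitAt`) and
  its bookkeeping lemmas (`joinAt_self`, `joinAt_val`, `update_joinAt_self`, `update_joinAt_val`,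
  `joinAt_apply_restrict`), `prod_eq_mul_prod_ne` (`∏ᵢ Fᵢ = F i₀ · ∏_{i ≠ i₀} Fᵢ`).
* §2 `mul_mem_span_blockContraction` — gluing: a contraction-span element in the colour-`i₀` block times a
  block-contraction-span element in the remaining blocks lies in the block-contraction span.
* §3 **`mem_span_blockContraction_of_invariant`** (via `_aux`, induction on the number of colours: peel
  colour `i₀`, apply the one-colour FFT to every slice, factor through a basis of the slice span, pass the
  invariance under the other colours to the coefficient functions by linearity, induct, glue): a coefficient
  tensor on block words fixed by every colour-`i` Kronecker power of every `g ∈ Sp(Ω i)` is a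
  `K`-combination of the block contractions of the `(Ω i)⁻¹`.
* §4 **`mem_span_patternContraction_of_blockDiagonal_invariant`** — the same for ONE tensor power
  `V^{⊗Q}` of `V = ⊕ᵢ Vᵢ`: letters in the graded alphabet `Σ i, Fin (N i)`, invariance under the `#Q`-fold
  Kronecker powers of the block-diagonal matrices `Matrix.blockDiagonal' g` (`g i ∈ Sp(Ω i)`); the
  invariants are spanned by the `patternContraction`s (a colour pattern `col : Q → ι`, two-partitions of
  its colour classes, same-coloured pairs contracted with `(Ω i)⁻¹`, zero off the pattern) — via
  `V^{⊗Q} = ⊕_{col} ⊗_q V_{col q}` (`eq_sum_extendByPattern`, `ofBlocks`/`toBlocks`) and the kernel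
  computation `sum_blockDiagonal_kernel_ofBlocks` reducing the block-diagonal action on one pattern to the
  block action of §3. For two colours: the FFT for `Sp(M₊) × Sp(M₋)` on `(M₊ ⊕ M₋)^{⊗Q}`,
  `dim M₊ ≠ dim M₋` allowed.

NOT here: orthogonal factors; the converse (each block contraction is invariant — immediate from the
one-colour `SymplecticTensorFFT.sum_prod_mul_completeContraction`).

## References

* [GoodmanWallachGTM255] R. Goodman, N. R. Wallach, Symmetry, Representations, and Invariants, GTM 255
  (2009), §5.3.2 Thm. 5.3.3 (2), Thm. 5.3.5; §4.1.1.
* [Milne1999LefschetzClasses] J. S. Milne, Lefschetz classes on abelian varieties, Duke Math. J. 96 (1999),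
  p. 656.
-/

noncomputable section

open scoped BigOperators Matrix

namespace Literature.RepresentationTheory.ClassicalInvariants

universe u v

variable {K : Type*} [Field K]

/-! ### §1 Two-partitions with their size, block words, block contractions -/

/-- A two-partition of a finite set of positions `P` into ordered pairs, packed with its number of pairs
`k` (`Σ k, P ≃ Fin 2 × Fin k`; Goodman–Wallach's sets `X_k` of two-partitions, all `k` at once).
[cite: GoodmanWallachGTM255, §5.3.2 (before Thm. 5.3.5)] -/
abbrev TwoPartition (P : Type v) : Type v := Σ k : ℕ, P ≃ Fin 2 × Fin k

section Blocks

variable {ι : Type u} {N : ι → ℕ} {P : ι → Type v}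

section Contraction

variable [Fintype ι]

/-- **The block (colour-respecting) complete contraction** attached to a family `e` of two-partitions of
the positions of each colour: `w ↦ ∏ᵢ λ_{e i}(Θ i)(w i)` — pairs only join positions of the same colour,
and a pair of colour `i` is contracted with `Θ i`. [cite: GoodmanWallachGTM255, §5.3.2 Thm. 5.3.5]
[cite: Milne1999LefschetzClasses, p. 656] -/
def blockContraction (Θ : (i : ι) → Matrix (Fin (N i)) (Fin (N i)) K) (e : (i : ι) → TwoPartition (P i)) :
    ((i : ι) → P i → Fin (N i)) → K :=
  fun w => ∏ i, completeContractionOn (Θ i) (e i).2 (w i)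

/-- Unfolding `blockContraction`. [cite: GoodmanWallachGTM255, §5.3.2 Thm. 5.3.5] -/
theorem blockContraction_apply (Θ : (i : ι) → Matrix (Fin (N i)) (Fin (N i)) K)
    (e : (i : ι) → TwoPartition (P i)) (w : (i : ι) → P i → Fin (N i)) :
    blockContraction Θ e w = ∏ i, completeContractionOn (Θ i) (e i).2 (w i) := rfl

end Contraction

section Join

variable [DecidableEq ι]

/-- The two components of `Equiv.piSplitAt i₀ β` recover a split family: the `i₀` component.
[cite: GoodmanWallachGTM255, §4.1.1] -/
theorem piSplitAt_symm_apply_self (i₀ : ι) {β : ι → Type v} (x : β i₀) (g : (j : {j // j ≠ i₀}) → β j.1) :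
    (Equiv.piSplitAt i₀ β).symm (x, g) i₀ = x :=
  congrArg Prod.fst ((Equiv.piSplitAt i₀ β).apply_symm_apply (x, g))

/-- The two components of `Equiv.piSplitAt i₀ β` recover a split family: the other components.
[cite: GoodmanWallachGTM255, §4.1.1] -/
theorem piSplitAt_symm_apply_val (i₀ : ι) {β : ι → Type v} (x : β i₀) (g : (j : {j // j ≠ i₀}) → β j.1)
    (j : {j // j ≠ i₀}) : (Equiv.piSplitAt i₀ β).symm (x, g) j.1 = g j :=
  congrFun (congrArg Prod.snd ((Equiv.piSplitAt i₀ β).apply_symm_apply (x, g))) j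

/-- The block word with colour-`i₀` block `u` and remaining blocks `r` (inverse of `Equiv.piSplitAt i₀`).
[cite: GoodmanWallachGTM255, §4.1.1] -/
def joinAt (i₀ : ι) (u : P i₀ → Fin (N i₀)) (r : (i : {i // i ≠ i₀}) → P i.1 → Fin (N i.1)) :
    (i : ι) → P i → Fin (N i) :=
  (Equiv.piSplitAt i₀ (fun i => P i → Fin (N i))).symm (u, r)

variable (i₀ : ι)

/-- The colour-`i₀` block of `joinAt i₀ u r` is `u`. [cite: GoodmanWallachGTM255, §4.1.1] -/
@[simp]
theorem joinAt_self (u : P i₀ → Fin (N i₀)) (r : (i : {i // i ≠ i₀}) → P i.1 → Fin (N i.1)) :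
    joinAt i₀ u r i₀ = u :=
  piSplitAt_symm_apply_self i₀ (β := fun i => P i → Fin (N i)) u r

/-- The other blocks of `joinAt i₀ u r` are those of `r`. [cite: GoodmanWallachGTM255, §4.1.1] -/
theorem joinAt_of_ne (u : P i₀ → Fin (N i₀)) (r : (i : {i // i ≠ i₀}) → P i.1 → Fin (N i.1)) {i : ι}
    (h : i ≠ i₀) : joinAt i₀ u r i = r ⟨i, h⟩ :=
  piSplitAt_symm_apply_val i₀ (β := fun i => P i → Fin (N i)) u r ⟨i, h⟩

/-- The other blocks of `joinAt i₀ u r` are those of `r` (subtype form). [cite: GoodmanWallachGTM255, §4.1.1] -/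
@[simp]
theorem joinAt_val (u : P i₀ → Fin (N i₀)) (r : (i : {i // i ≠ i₀}) → P i.1 → Fin (N i.1))
    (i : {i // i ≠ i₀}) : joinAt i₀ u r i.1 = r i := by
  rw [joinAt_of_ne i₀ u r i.2]

/-- Replacing the colour-`i₀` block. [cite: GoodmanWallachGTM255, §4.1.1] -/
theorem update_joinAt_self (u u' : P i₀ → Fin (N i₀)) (r : (i : {i // i ≠ i₀}) → P i.1 → Fin (N i.1)) :
    Function.update (joinAt i₀ u r) i₀ u' = joinAt i₀ u' r := by
  funext i
  by_cases h : i = i₀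
  · subst h
    rw [Function.update_self, joinAt_self]
  · rw [Function.update_of_ne h, joinAt_of_ne i₀ u r h, joinAt_of_ne i₀ u' r h]

/-- Replacing another block. [cite: GoodmanWallachGTM255, §4.1.1] -/
theorem update_joinAt_val (u : P i₀ → Fin (N i₀)) (r : (i : {i // i ≠ i₀}) → P i.1 → Fin (N i.1))
    (i : {i // i ≠ i₀}) (v : P i.1 → Fin (N i.1)) :
    Function.update (joinAt i₀ u r) i.1 v = joinAt i₀ u (Function.update r i v) := by
  funext i'
  by_cases h' : i' = i.1
  · subst h'
    rw [Function.update_self, joinAt_val, Function.update_self]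
  · rw [Function.update_of_ne h']
    by_cases h₀ : i' = i₀
    · subst h₀
      rw [joinAt_self, joinAt_self]
    · rw [joinAt_of_ne i₀ u r h₀, joinAt_of_ne i₀ u _ h₀, Function.update_of_ne]
      exact fun e => h' (congrArg Subtype.val e)

/-- Every block word is `joinAt i₀` of its colour-`i₀` block and its other blocks.
[cite: GoodmanWallachGTM255, §4.1.1] -/
theorem joinAt_apply_restrict (w : (i : ι) → P i → Fin (N i)) :
    joinAt i₀ (w i₀) (fun i => w i.1) = w :=
  (Equiv.piSplitAt i₀ (fun i => P i → Fin (N i))).symm_apply_apply w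

end Join

section Glue

variable [Fintype ι] [DecidableEq ι] (i₀ : ι)

/-- `∏ᵢ F i = F i₀ · ∏_{i ≠ i₀} F i` (product split at one index, subtype form). [folklore] -/
private theorem prod_eq_mul_prod_ne (F : ι → K) :
    ∏ i, F i = F i₀ * ∏ i : {i // i ≠ i₀}, F i.1 := by
  rw [← Finset.mul_prod_erase Finset.univ F (Finset.mem_univ i₀)]
  congr 1
  refine (Finset.prod_subtype (Finset.univ.erase i₀) (fun i => ?_) F)
  simp

/-! ### §2 Gluing a colour-`i₀` contraction with a block contraction of the other colours -/

/-- **Gluing**: if `f` lies in the span of the complete contractions (with `Θ i₀`) on the colour-`i₀`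
block and `d` in the span of the block contractions (with the `Θ i`, `i ≠ i₀`) on the other blocks, then
`w ↦ f(w i₀) · d(w|_{i ≠ i₀})` lies in the span of the block contractions with `Θ` — the product of a
two-partition of the `i₀`-positions and two-partitions of the other blocks is a family of two-partitions
of all blocks. [cite: GoodmanWallachGTM255, §4.1.1 and §5.3.2 Thm. 5.3.5] -/
theorem mul_mem_span_blockContraction (Θ : (i : ι) → Matrix (Fin (N i)) (Fin (N i)) K)
    {f : (P i₀ → Fin (N i₀)) → K} {d : ((i : {i // i ≠ i₀}) → P i.1 → Fin (N i.1)) → K}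
    (hf : f ∈ Submodule.span K {f : (P i₀ → Fin (N i₀)) → K |
      ∃ (k : ℕ) (e : P i₀ ≃ Fin 2 × Fin k), f = completeContractionOn (Θ i₀) e})
    (hd : d ∈ Submodule.span K (Set.range
      (blockContraction (fun i : {i // i ≠ i₀} => Θ i.1) :
        ((i : {i // i ≠ i₀}) → TwoPartition (P i.1)) → _))) :
    (fun w : (i : ι) → P i → Fin (N i) => f (w i₀) * d (fun i => w i.1)) ∈
      Submodule.span K (Set.range (blockContraction Θ : ((i : ι) → TwoPartition (P i)) → _)) := by
  -- linear in `f`: reduce to a single contraction `f = λ_{e₀}`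
  induction hf using Submodule.span_induction with
  | mem f hf =>
    obtain ⟨k₀, e₀, rfl⟩ := hf
    -- linear in `d`: reduce to a single block contraction
    induction hd using Submodule.span_induction with
    | mem d hd =>
      obtain ⟨e', rfl⟩ := hd
      refine Submodule.subset_span ⟨(Equiv.piSplitAt i₀ (fun i => TwoPartition (P i))).symm
        (⟨k₀, e₀⟩, e'), ?_⟩
      funext w
      rw [blockContraction_apply, prod_eq_mul_prod_ne i₀, blockContraction_apply]
      congr 1
      · exact congrArg (fun t : TwoPartition (P i₀) => completeContractionOn (Θ i₀) t.2 (w i₀))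
          (piSplitAt_symm_apply_self i₀ (β := fun i => TwoPartition (P i)) ⟨k₀, e₀⟩ e')
      · refine Finset.prod_congr rfl fun i _ => ?_
        exact congrArg (fun t : TwoPartition (P i.1) => completeContractionOn (Θ i.1) t.2 (w i.1))
          (piSplitAt_symm_apply_val i₀ (β := fun i => TwoPartition (P i)) ⟨k₀, e₀⟩ e' i)
    | zero =>
      have h0 : (fun w : (i : ι) → P i → Fin (N i) =>
          completeContractionOn (Θ i₀) e₀ (w i₀) * (0 : ((i : {i // i ≠ i₀}) → P i.1 → Fin (N i.1)) → K)
            (fun i => w i.1)) = 0 := by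
        funext w; simp
      rw [h0]; exact Submodule.zero_mem _
    | add d₁ d₂ _ _ h₁ h₂ =>
      have hadd : (fun w : (i : ι) → P i → Fin (N i) =>
          completeContractionOn (Θ i₀) e₀ (w i₀) * (d₁ + d₂) (fun i => w i.1)) =
          (fun w => completeContractionOn (Θ i₀) e₀ (w i₀) * d₁ (fun i => w i.1)) +
            fun w => completeContractionOn (Θ i₀) e₀ (w i₀) * d₂ (fun i => w i.1) := by
        funext w; simp [mul_add]
      rw [hadd]; exact Submodule.add_mem _ h₁ h₂
    | smul a d _ h =>
      have hsmul : (fun w : (i : ι) → P i → Fin (N i) =>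
          completeContractionOn (Θ i₀) e₀ (w i₀) * (a • d) (fun i => w i.1)) =
          a • fun w => completeContractionOn (Θ i₀) e₀ (w i₀) * d (fun i => w i.1) := by
        funext w; simp [mul_left_comm]
      rw [hsmul]; exact Submodule.smul_mem _ a h
  | zero =>
    have h0 : (fun w : (i : ι) → P i → Fin (N i) =>
        (0 : (P i₀ → Fin (N i₀)) → K) (w i₀) * d (fun i => w i.1)) = 0 := by
      funext w; simp
    rw [h0]; exact Submodule.zero_mem _
  | add f₁ f₂ _ _ h₁ h₂ =>
    have hadd : (fun w : (i : ι) → P i → Fin (N i) => (f₁ + f₂) (w i₀) * d (fun i => w i.1)) =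
        (fun w => f₁ (w i₀) * d (fun i => w i.1)) + fun w => f₂ (w i₀) * d (fun i => w i.1) := by
      funext w; simp [add_mul]
    rw [hadd]; exact Submodule.add_mem _ h₁ h₂
  | smul a f _ h =>
    have hsmul : (fun w : (i : ι) → P i → Fin (N i) => (a • f) (w i₀) * d (fun i => w i.1)) =
        a • fun w => f (w i₀) * d (fun i => w i.1) := by
      funext w; simp [mul_assoc]
    rw [hsmul]; exact Submodule.smul_mem _ a h

end Glue

end Blocks

/-! ### §3 The block FFT -/

/-- **Tensor FFT for `∏ᵢ Sp(Ω i)` with colour-dependent alphabets — inductive form** (all data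
quantified, induction on the number of colours). [cite: GoodmanWallachGTM255, §5.3.2 Thm. 5.3.3 (2), Thm. 5.3.5 and §4.1.1]
[cite: Milne1999LefschetzClasses, p. 656] -/
theorem mem_span_blockContraction_of_invariant_aux [CharZero K] :
    ∀ (n : ℕ) (ι : Type u) [Fintype ι] [DecidableEq ι] (N : ι → ℕ) (P : ι → Type v)
      [∀ i, Fintype (P i)] [∀ i, DecidableEq (P i)]
      (Ω : (i : ι) → Matrix (Fin (N i)) (Fin (N i)) K),
      (∀ i, (Matrix.toBilin' (Ω i)).IsAlt) → (∀ i, (Matrix.toBilin' (Ω i)).Nondegenerate) →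
      Fintype.card ι = n →
      ∀ (c : ((i : ι) → P i → Fin (N i)) → K),
        (∀ (i : ι) (g : Matrix (Fin (N i)) (Fin (N i)) K), gᵀ * Ω i * g = Ω i →
          ∀ w' : (i : ι) → P i → Fin (N i),
            (∑ u : P i → Fin (N i), (∏ p, g (w' i p) (u p)) * c (Function.update w' i u)) = c w') →
        c ∈ Submodule.span K
          (Set.range (blockContraction (fun i => (Ω i)⁻¹) : ((i : ι) → TwoPartition (P i)) → _)) := by
  intro n
  induction n with
  | zero =>
    intro ι _ _ N P _ _ Ω hΩa hΩn hcard c hc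
    haveI : IsEmpty ι := Fintype.card_eq_zero_iff.1 hcard
    let e₀ : (i : ι) → TwoPartition (P i) := fun i => isEmptyElim i
    let w₀ : (i : ι) → P i → Fin (N i) := fun i => isEmptyElim i
    have hc1 : c = c w₀ • blockContraction (fun i => (Ω i)⁻¹) e₀ := by
      funext w
      rw [Pi.smul_apply, blockContraction_apply, Finset.univ_eq_empty, Finset.prod_empty, smul_eq_mul,
        mul_one, Subsingleton.elim w w₀]
    rw [hc1]
    exact Submodule.smul_mem _ _ (Submodule.subset_span ⟨e₀, rfl⟩)
  | succ n IH =>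
    intro ι _ _ N P _ _ Ω hΩa hΩn hcard c hc
    obtain ⟨i₀⟩ : Nonempty ι := Fintype.card_pos_iff.1 (by omega)
    -- the two-argument form of `c`: colour-`i₀` block and the rest
    let c₂ : (P i₀ → Fin (N i₀)) → ((i : {i // i ≠ i₀}) → P i.1 → Fin (N i.1)) → K :=
      fun u r => c (joinAt i₀ u r)
    -- (1) every slice is `Sp(Ω i₀)`-invariant, hence in the span of the colour-`i₀` contractions
    have hslice : ∀ r, (fun u => c₂ u r) ∈ Submodule.span K {f : (P i₀ → Fin (N i₀)) → K |
        ∃ (k : ℕ) (e : P i₀ ≃ Fin 2 × Fin k), f = completeContractionOn (Ω i₀)⁻¹ e} := by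
      intro r
      refine mem_span_completeContractionOn_inv_of_sp_invariant (hΩa i₀) (hΩn i₀) _ fun g hg u' => ?_
      have h := hc i₀ g hg (joinAt i₀ u' r)
      simp only [update_joinAt_self, joinAt_self] at h
      exact h
    -- (2) factor through a basis of the slice span
    obtain ⟨m, f, L, hfU, hcf⟩ := exists_sum_mul_of_slices_mem _ c₂ hslice
    let d : Fin m → (((i : {i // i ≠ i₀}) → P i.1 → Fin (N i.1)) → K) :=
      fun j r => L j (fun u => c₂ u r)
    -- (3) the coefficient functions are invariant under the remaining colours
    have hd : ∀ (j : Fin m) (i : {i // i ≠ i₀}) (g : Matrix (Fin (N i.1)) (Fin (N i.1)) K),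
        gᵀ * Ω i.1 * g = Ω i.1 → ∀ r' : (i : {i // i ≠ i₀}) → P i.1 → Fin (N i.1),
          (∑ v : P i.1 → Fin (N i.1), (∏ p, g (r' i p) (v p)) * d j (Function.update r' i v)) =
            d j r' := by
      intro j i g hg r'
      have key : (fun u => c₂ u r') = ∑ v : P i.1 → Fin (N i.1),
          (∏ p, g (r' i p) (v p)) • (fun u => c₂ u (Function.update r' i v)) := by
        funext u
        simp only [Finset.sum_apply, Pi.smul_apply, smul_eq_mul, c₂]
        have h := hc i.1 g hg (joinAt i₀ u r')
        simp only [update_joinAt_val, joinAt_val] at h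
        exact h.symm
      show (∑ v : P i.1 → Fin (N i.1), (∏ p, g (r' i p) (v p)) * L j (fun u => c₂ u (Function.update r' i v))) =
        L j (fun u => c₂ u r')
      rw [key, map_sum]
      simp_rw [map_smul, smul_eq_mul]
    -- (4) induction hypothesis for the remaining colours
    have hcard' : Fintype.card {i // i ≠ i₀} = n := by
      rw [Fintype.card_subtype_compl, Fintype.card_subtype_eq, hcard, Nat.add_sub_cancel]
    have hdspan : ∀ j, d j ∈ Submodule.span K (Set.range
        (blockContraction (fun i : {i // i ≠ i₀} => (Ω i.1)⁻¹) :
          ((i : {i // i ≠ i₀}) → TwoPartition (P i.1)) → _)) :=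
      fun j => IH {i // i ≠ i₀} (fun i => N i.1) (fun i => P i.1) (fun i => Ω i.1) (fun i => hΩa i.1)
        (fun i => hΩn i.1) hcard' (d j) (hd j)
    -- (5) reassemble `c`
    have hcw : c = ∑ j, (fun w => f j (w i₀) * d j (fun i => w i.1)) := by
      funext w
      rw [Finset.sum_apply]
      have e := hcf (w i₀) (fun i => w i.1)
      simp only [c₂, joinAt_apply_restrict] at e
      rw [e]
      exact Finset.sum_congr rfl fun j _ => mul_comm _ _
    rw [hcw]
    exact Submodule.sum_mem _ fun j _ => mul_mem_span_blockContraction i₀ _ (hfU j) (hdspan j)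

/-- **Tensor FFT for a product of symplectic groups with colour-dependent alphabets** (Goodman–Wallach
Thm. 5.3.3 (2), block form; `char K = 0`). Colours `ι`; for each colour `i` a finite set of positions
`P i`, an alphabet `Fin (N i)` and an alternating nondegenerate `Ω i` (so `N i` is even). If a coefficient
tensor `c` on block words `w : (i : ι) → P i → Fin (N i)` is fixed by the colour-`i` Kronecker power of
every `g ∈ Sp(Ω i)` for every `i` —
`∑_u (∏_{p ∈ P i} g_{w' i p, u p}) · c(w' with block i replaced by u) = c(w')` — then `c` is a
`K`-linear combination of the block contractions `w ↦ ∏ᵢ λ_{e i}((Ω i)⁻¹)(w i)` over families `e` of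
two-partitions of the `P i` (in particular `c = 0` if some `#P i` is odd, there being no such family).
The uniform-alphabet case is the tree's `mem_span_colouredContraction_of_forall_wordRepAt_eq`.
[cite: GoodmanWallachGTM255, §5.3.2 Thm. 5.3.3 (2), Thm. 5.3.5 and §4.1.1] [cite: Milne1999LefschetzClasses, p. 656] -/
theorem mem_span_blockContraction_of_invariant [CharZero K] {ι : Type u} [Fintype ι] [DecidableEq ι]
    {N : ι → ℕ} {P : ι → Type v} [∀ i, Fintype (P i)] [∀ i, DecidableEq (P i)]
    (Ω : (i : ι) → Matrix (Fin (N i)) (Fin (N i)) K)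
    (hΩa : ∀ i, (Matrix.toBilin' (Ω i)).IsAlt) (hΩn : ∀ i, (Matrix.toBilin' (Ω i)).Nondegenerate)
    (c : ((i : ι) → P i → Fin (N i)) → K)
    (hc : ∀ (i : ι) (g : Matrix (Fin (N i)) (Fin (N i)) K), gᵀ * Ω i * g = Ω i →
      ∀ w' : (i : ι) → P i → Fin (N i),
        (∑ u : P i → Fin (N i), (∏ p, g (w' i p) (u p)) * c (Function.update w' i u)) = c w') :
    c ∈ Submodule.span K
      (Set.range (blockContraction (fun i => (Ω i)⁻¹) : ((i : ι) → TwoPartition (P i)) → _)) :=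
  mem_span_blockContraction_of_invariant_aux (Fintype.card ι) ι N P Ω hΩa hΩn rfl c hc

/-! ### §4 Block-diagonal form: one set of positions, letters in the graded alphabet `Σ i, Fin (N i)`

The same theorem in the shape of ONE tensor power: positions `Q`, the alphabet of `V = ⊕ᵢ Vᵢ` is the
graded `Σ i, Fin (N i)` (a letter = a colour and a basis vector of that colour), and the product group
`∏ᵢ Sp(Ω i)` acts through the block-diagonal matrices `Matrix.blockDiagonal' g` by the `#Q`-fold Kronecker
power. An invariant coefficient tensor is a combination of the PATTERN CONTRACTIONS: a colour pattern
`col : Q → ι` together with two-partitions of each colour class `{q // col q = i}`, contracted with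
`(Ω i)⁻¹`, extended by zero off the words of pattern `col`. (This is `V^{⊗Q} = ⊕_{col} ⊗_q V_{col q}`
followed by §3 on each summand.) -/

section BlockDiagonal

variable {ι : Type u} [Fintype ι] [DecidableEq ι] {N : ι → ℕ} {Q : Type v} [Fintype Q] [DecidableEq Q]

/-- The colour pattern of a word in the graded alphabet. [cite: GoodmanWallachGTM255, §4.1.1] -/
def pattern (w : Q → Σ i, Fin (N i)) : Q → ι := fun q => (w q).1

/-- The word of pattern `col` with block letters `r`. [cite: GoodmanWallachGTM255, §4.1.1] -/
def ofBlocks (col : Q → ι) (r : (i : ι) → {q // col q = i} → Fin (N i)) : Q → Σ i, Fin (N i) :=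
  fun q => ⟨col q, r (col q) ⟨q, rfl⟩⟩

/-- The block letters of a word of pattern `col`. [cite: GoodmanWallachGTM255, §4.1.1] -/
def toBlocks (col : Q → ι) (w : Q → Σ i, Fin (N i)) (h : pattern w = col) :
    (i : ι) → {q // col q = i} → Fin (N i) :=
  fun _ q => Fin.cast (congrArg N ((congrFun h q.1).trans q.2)) (w q.1).2

omit [Fintype ι] [DecidableEq ι] [Fintype Q] [DecidableEq Q] in
/-- Evaluating a colour-indexed family at the tautological point of a fibre. [folklore] -/
private theorem apply_fiber_mk {α : Sort*} {col : Q → ι} (T : (j : ι) → {q // col q = j} → α) {i : ι}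
    (p : {q // col q = i}) : T (col p.1) ⟨p.1, rfl⟩ = T i p := by
  obtain ⟨q, hq⟩ := p
  subst hq
  rfl

omit [Fintype ι] [DecidableEq ι] [Fintype Q] [DecidableEq Q] in
/-- A graded letter is determined by its colour and its recast index. [folklore] -/
private theorem sigma_eq_cast (x : Σ i, Fin (N i)) (j : ι) (hj : x.1 = j) :
    (⟨j, Fin.cast (congrArg N hj) x.2⟩ : Σ i, Fin (N i)) = x := by
  obtain ⟨i, a⟩ := x
  cases hj
  rfl

omit [Fintype ι] [DecidableEq ι] [Fintype Q] [DecidableEq Q] in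
/-- `pattern (ofBlocks col r) = col`. [cite: GoodmanWallachGTM255, §4.1.1] -/
@[simp]
theorem pattern_ofBlocks (col : Q → ι) (r : (i : ι) → {q // col q = i} → Fin (N i)) :
    pattern (ofBlocks col r) = col := rfl

omit [Fintype ι] [DecidableEq ι] [Fintype Q] [DecidableEq Q] in
/-- A word is `ofBlocks` of its pattern and its block letters. [cite: GoodmanWallachGTM255, §4.1.1] -/
theorem ofBlocks_toBlocks (col : Q → ι) (w : Q → Σ i, Fin (N i)) (h : pattern w = col) :
    ofBlocks col (toBlocks col w h) = w := by
  funext q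
  exact sigma_eq_cast (w q) (col q) (congrFun h q)

omit [Fintype ι] [DecidableEq ι] [Fintype Q] [DecidableEq Q] in
/-- `ofBlocks col` is injective. [cite: GoodmanWallachGTM255, §4.1.1] -/
theorem ofBlocks_injective (col : Q → ι) : Function.Injective (ofBlocks (N := N) col) := by
  intro r₁ r₂ h
  funext i p
  obtain ⟨q, hq⟩ := p
  subst hq
  have hq := congrFun h q
  simp only [ofBlocks, Sigma.mk.inj_iff, heq_eq_eq, true_and] at hq
  exact hq

/-- **Extension by zero off a pattern**: a function of block words of pattern `col`, viewed as a coefficient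
tensor on all words (zero on words of other patterns). [cite: GoodmanWallachGTM255, §4.1.1] -/
def extendByPattern (col : Q → ι) (F : ((i : ι) → {q // col q = i} → Fin (N i)) → K) :
    (Q → Σ i, Fin (N i)) → K :=
  fun w => if h : pattern w = col then F (toBlocks col w h) else 0

/-- `extendByPattern col` is `K`-linear. [cite: GoodmanWallachGTM255, §4.1.1] -/
def extendByPatternₗ (col : Q → ι) :
    (((i : ι) → {q // col q = i} → Fin (N i)) → K) →ₗ[K] ((Q → Σ i, Fin (N i)) → K) where
  toFun := extendByPattern col
  map_add' F G := by
    funext w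
    simp only [extendByPattern, Pi.add_apply]
    split_ifs <;> simp
  map_smul' a F := by
    funext w
    simp only [extendByPattern, Pi.smul_apply, smul_eq_mul, RingHom.id_apply]
    split_ifs <;> simp

omit [Fintype ι] [DecidableEq Q] in
/-- Unfolding `extendByPatternₗ`. [cite: GoodmanWallachGTM255, §4.1.1] -/
theorem extendByPatternₗ_apply (col : Q → ι) (F : ((i : ι) → {q // col q = i} → Fin (N i)) → K) :
    extendByPatternₗ (K := K) col F = extendByPattern col F := rfl

omit [Fintype ι] [DecidableEq Q] in
/-- On a word of pattern `col`, the extension evaluates `F` at its block letters.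
[cite: GoodmanWallachGTM255, §4.1.1] -/
theorem extendByPattern_ofBlocks (col : Q → ι) (F : ((i : ι) → {q // col q = i} → Fin (N i)) → K)
    (r : (i : ι) → {q // col q = i} → Fin (N i)) :
    extendByPattern col F (ofBlocks col r) = F r := by
  unfold extendByPattern
  rw [dif_pos (pattern_ofBlocks col r)]
  congr 1
  exact ofBlocks_injective col (ofBlocks_toBlocks col _ _)

/-- **The pattern contraction** attached to a colour pattern `col : Q → ι` and two-partitions `e i` of
its colour classes: on words of pattern `col`, the product over colours of the complete contractions of
the colour-`i` letters with `Θ i`; zero on other words. [cite: GoodmanWallachGTM255, §5.3.2 Thm. 5.3.5 and §4.1.1] -/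
def patternContraction (Θ : (i : ι) → Matrix (Fin (N i)) (Fin (N i)) K) (col : Q → ι)
    (e : (i : ι) → TwoPartition {q // col q = i}) : (Q → Σ i, Fin (N i)) → K :=
  extendByPattern col (blockContraction Θ e)

/-- A coefficient tensor is the sum over patterns of the extensions of its restrictions.
[cite: GoodmanWallachGTM255, §4.1.1] -/
theorem eq_sum_extendByPattern (c : (Q → Σ i, Fin (N i)) → K) :
    c = ∑ col : Q → ι, extendByPattern col (fun r => c (ofBlocks col r)) := by
  funext w
  rw [Finset.sum_apply, Finset.sum_eq_single_of_mem (pattern w) (Finset.mem_univ _)]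
  · unfold extendByPattern
    rw [dif_pos rfl]
    simp only [ofBlocks_toBlocks]
  · intro col _ hcol
    unfold extendByPattern
    rw [dif_neg (Ne.symm hcol)]

/-- **The block-diagonal Kronecker action restricted to one pattern is the block action of §3.** For
`g ∈` (matrices of) colour `i`, `g♯ = (1, …, g, …, 1)` and a block word `r'` of pattern `col`:
`∑_w (∏_q blockDiagonal' g♯ ((ofBlocks col r') q) (w q)) · c w = ∑_u (∏_{p ∈ col⁻¹ i} g (r' i p) (u p)) · c (ofBlocks col (r' with block i := u))`
— the kernel vanishes off the words `ofBlocks col (update r' i u)` and equals the colour-`i` Kronecker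
factor on them. [cite: GoodmanWallachGTM255, §4.1.1] -/
theorem sum_blockDiagonal_kernel_ofBlocks (c : (Q → Σ i, Fin (N i)) → K) (col : Q → ι) (i : ι)
    (g : Matrix (Fin (N i)) (Fin (N i)) K) (r' : (i : ι) → {q // col q = i} → Fin (N i)) :
    (∑ w : Q → Σ i, Fin (N i),
        (∏ q, Matrix.blockDiagonal' (Function.update (1 : (j : ι) → Matrix (Fin (N j)) (Fin (N j)) K) i g)
          (ofBlocks col r' q) (w q)) * c w) =
      ∑ u : {q // col q = i} → Fin (N i),
        (∏ p, g (r' i p) (u p)) * c (ofBlocks col (Function.update r' i u)) := by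
  set G : (j : ι) → Matrix (Fin (N j)) (Fin (N j)) K := Function.update 1 i g with hG
  -- the words in the image of `φ u := ofBlocks col (update r' i u)`
  let φ : ({q // col q = i} → Fin (N i)) → (Q → Σ i, Fin (N i)) :=
    fun u => ofBlocks col (Function.update r' i u)
  have hφ : Function.Injective φ := fun u₁ u₂ h =>
    Function.update_injective r' i (ofBlocks_injective col h)
  -- kernel on block words of pattern `col`, fibrewise
  have hker : ∀ r : (i : ι) → {q // col q = i} → Fin (N i),
      (∏ q, Matrix.blockDiagonal' G (ofBlocks col r' q) (ofBlocks col r q)) =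
        ∏ j, ∏ p : {q // col q = j}, G j (r' j p) (r j p) := by
    intro r
    rw [← Fintype.prod_fiberwise col]
    refine Fintype.prod_congr _ _ fun j => Fintype.prod_congr _ _ fun p => ?_
    simp only [ofBlocks, Matrix.blockDiagonal'_apply_eq]
    exact apply_fiber_mk (fun j x => G j (r' j x) (r j x)) p
  -- (B) the kernel on the image
  have hB : ∀ u, (∏ q, Matrix.blockDiagonal' G (ofBlocks col r' q) (φ u q)) = ∏ p, g (r' i p) (u p) := by
    intro u
    rw [hker, prod_eq_mul_prod_ne i]
    have h1 : ∀ j : {j // j ≠ i}, (∏ p : {q // col q = j.1}, G j.1 (r' j.1 p)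
        (Function.update r' i u j.1 p)) = 1 := by
      intro j
      refine Finset.prod_eq_one fun p _ => ?_
      rw [hG, Function.update_of_ne j.2, Function.update_of_ne j.2, Pi.one_apply, Matrix.one_apply_eq]
    simp only [h1, Finset.prod_const_one, mul_one]
    refine Finset.prod_congr rfl fun p _ => ?_
    rw [hG, Function.update_self, Function.update_self]
  -- (C) the kernel vanishes off the image
  have hC : ∀ w, (∏ q, Matrix.blockDiagonal' G (ofBlocks col r' q) (w q)) ≠ 0 → w ∈ Set.range φ := by
    intro w hw
    have hfac : ∀ q, Matrix.blockDiagonal' G (ofBlocks col r' q) (w q) ≠ 0 := fun q h0 =>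
      hw (Finset.prod_eq_zero (Finset.mem_univ q) h0)
    have hpat : pattern w = col := by
      funext q
      by_contra hq
      apply hfac q
      have e : w q = ⟨(w q).1, (w q).2⟩ := rfl
      rw [e, ofBlocks]
      exact Matrix.blockDiagonal'_apply_ne G _ _ (Ne.symm hq)
    set r := toBlocks col w hpat with hr
    have hw' : w = ofBlocks col r := (ofBlocks_toBlocks col w hpat).symm
    have hagree : ∀ j, j ≠ i → r j = r' j := by
      intro j hj
      funext p
      have h := hfac p.1
      rw [hw'] at h
      have e : Matrix.blockDiagonal' G (ofBlocks col r' p.1) (ofBlocks col r p.1) = G j (r' j p) (r j p) := by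
        simp only [ofBlocks, Matrix.blockDiagonal'_apply_eq]
        exact apply_fiber_mk (fun j x => G j (r' j x) (r j x)) p
      rw [e, hG, Function.update_of_ne hj, Pi.one_apply, Matrix.one_apply] at h
      by_contra hne
      exact h (if_neg (Ne.symm hne))
    refine ⟨r i, ?_⟩
    show ofBlocks col (Function.update r' i (r i)) = w
    rw [hw']
    congr 1
    funext j
    by_cases hj : j = i
    · subst hj; rw [Function.update_self]
    · rw [Function.update_of_ne hj, hagree j hj]
  -- assemble: restrict the sum to the image, reindex by `u`
  rw [← Finset.sum_subset (Finset.subset_univ (Finset.univ.image φ))]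
  · rw [Finset.sum_image fun u₁ _ u₂ _ h => hφ h]
    exact Finset.sum_congr rfl fun u _ => by rw [hB]
  · intro w _ hw
    have h0 : (∏ q, Matrix.blockDiagonal' G (ofBlocks col r' q) (w q)) = 0 := by
      by_contra h
      obtain ⟨u, rfl⟩ := hC w h
      exact hw (Finset.mem_image_of_mem φ (Finset.mem_univ u))
    rw [h0, zero_mul]

/-- **Tensor FFT for `∏ᵢ Sp(Ω i) ⊂ GL(⊕ᵢ Vᵢ)` on `V^{⊗Q}`, block-diagonal form** (Goodman–Wallach Thm.
5.3.3 (2) for each factor + §4.1.1; `char K = 0`): a coefficient tensor `c` on words `Q → Σ i, Fin (N i)`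
fixed by the `#Q`-fold Kronecker power of every block-diagonal `blockDiagonal' g`, `(g i)ᵀ Ω i (g i) = Ω i`
for all `i`, is a `K`-combination of the pattern contractions `patternContraction (Ω⁻¹) col e` (colour
pattern `col : Q → ι`, two-partitions `e i` of the colour classes, contraction of same-coloured pairs with
`(Ω i)⁻¹`, zero off the pattern). With two colours of different dimensions this is the FFT for
`Sp(M₊) × Sp(M₋)` on `(M₊ ⊕ M₋)^{⊗Q}`: invariants are spanned by the complete contractions with the
block pairings `B₊ ⊕ 0`, `0 ⊕ B₋`. [cite: GoodmanWallachGTM255, §5.3.2 Thm. 5.3.3 (2), Thm. 5.3.5 and §4.1.1]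
[cite: Milne1999LefschetzClasses, p. 656] -/
theorem mem_span_patternContraction_of_blockDiagonal_invariant [CharZero K]
    (Ω : (i : ι) → Matrix (Fin (N i)) (Fin (N i)) K)
    (hΩa : ∀ i, (Matrix.toBilin' (Ω i)).IsAlt) (hΩn : ∀ i, (Matrix.toBilin' (Ω i)).Nondegenerate)
    (c : (Q → Σ i, Fin (N i)) → K)
    (hc : ∀ g : (i : ι) → Matrix (Fin (N i)) (Fin (N i)) K, (∀ i, (g i)ᵀ * Ω i * g i = Ω i) →
      ∀ w' : Q → Σ i, Fin (N i),
        (∑ w : Q → Σ i, Fin (N i), (∏ q, Matrix.blockDiagonal' g (w' q) (w q)) * c w) = c w') :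
    c ∈ Submodule.span K {f : (Q → Σ i, Fin (N i)) → K |
      ∃ (col : Q → ι) (e : (i : ι) → TwoPartition {q // col q = i}),
        f = patternContraction (fun i => (Ω i)⁻¹) col e} := by
  rw [eq_sum_extendByPattern c]
  refine Submodule.sum_mem _ fun col _ => ?_
  -- the restriction to pattern `col` satisfies the block hypothesis of §3
  have hres : (fun r => c (ofBlocks col r)) ∈ Submodule.span K (Set.range
      (blockContraction (fun i => (Ω i)⁻¹) : ((i : ι) → TwoPartition {q // col q = i}) → _)) := by
    refine mem_span_blockContraction_of_invariant Ω hΩa hΩn _ fun i g hg r' => ?_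
    have hG : ∀ j, (Function.update (1 : (j : ι) → Matrix (Fin (N j)) (Fin (N j)) K) i g j)ᵀ * Ω j *
        Function.update (1 : (j : ι) → Matrix (Fin (N j)) (Fin (N j)) K) i g j = Ω j := by
      intro j
      by_cases hj : j = i
      · subst hj; rw [Function.update_self]; exact hg
      · rw [Function.update_of_ne hj, Pi.one_apply, Matrix.transpose_one, Matrix.one_mul, Matrix.mul_one]
    have h := hc _ hG (ofBlocks col r')
    rw [sum_blockDiagonal_kernel_ofBlocks] at h
    exact h
  -- extend by zero: linear image of the §3 span
  have himg := Submodule.apply_mem_span_image_of_mem_span (extendByPatternₗ (K := K) col) hres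
  rw [extendByPatternₗ_apply] at himg
  refine Submodule.span_mono ?_ himg
  rintro _ ⟨_, ⟨e, rfl⟩, rfl⟩
  exact ⟨col, e, rfl⟩

end BlockDiagonal

end Literature.RepresentationTheory.ClassicalInvariants

end
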